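import Literature.Probability.RandomPlanarGeometry.LeftFillingConfigs
import HarnessLib

/-!
# The asymmetry of SLE(8/3, ρ), ρ < 0 ([LSW] proof of Cor. 8.6, p. 38): the two printed sentences, and the non-strict half from Thm. 8.4

Level 5 of the decomposition of the named fact
`Literature.Probability.RandomPlanarGeometry.IsRestrictionMeasure.eq_five_eighths_of_simple`
(plan in `RestrictionMeasuresFiveEighths`, `RestrictionLeftFillLaw`, `OneSidedRestriction`,
`SLEKappaRho`), after

* G. F. Lawler, O. Schramm, W. Werner, *Conformal restriction: the chordal case*, J. Amer. Math.
  Soc. **16** (2003) 917–955, arXiv:math/0209343 (**[LSW]**; arXiv page numbers as in the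
  sibling files): the proof of Cor. 8.6 (p. 38), §8.2 (the sentence preceding Prop. 8.2)
  and §8.3 (the definition of SLE(κ, ρ)).

This file decomposes the named fact `SLEKappaRho.one_half_lt_measure_I_notMem_fill` of
`SLEKappaRho` — for `−2 < ρ < 0` and every SLE(8/3, ρ) driving pair,
`P{i ∉ F^{ℝ₊}_ℍ(cl K_∞)} > 1/2` — whose ONLY printed justification is ([LSW] p. 38): "Note that
when `ρ < 0`, `W_t − √κ B_t` is decreasing. It follows easily that the probability that `i`
ends up eventually to 'the right' of the right hand boundary of SLE(8/3, ρ) (i.e., `i` is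
separated from `1` by `K_∞ ∪ (−∞, 0]`), is strictly larger than the corresponding quantity for
SLE(8/3, 0), which is `1/2` by symmetry." The two sentences are vendored separately:

* `Literature.Probability.RandomPlanarGeometry.SLEKappaRho.measure_I_notMem_fill_eq_half` —
  NAMED FACT (DISCHARGED in `RestrictionMeasuresFiveEighthsProofs`, see the status paragraph
  below), "the corresponding quantity for SLE(8/3, 0), which is `1/2` by symmetry": for
  every SLE(8/3, 0) driving pair `(O, W)` (for `ρ = 0`, `W = √κ B` a.s. and "we get the ordinary
  chordal SLE_κ", §8.3), `P{i ∉ F^{ℝ₊}_ℍ(cl K_∞)} = 1/2`;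
* `Literature.Probability.RandomPlanarGeometry.SLEKappaRho.measure_I_notMem_fill_lt_of_neg` —
  NAMED FACT (EQUIVALENT to the parent once the symmetry sentence is proved, hence merged back
  into the parent's proof obligation by the split review, see below), the comparison: for
  `−2 < ρ < 0` the probability of `{i ∉ F^{ℝ₊}_ℍ(cl K_∞)}` for SLE(8/3, ρ) is strictly larger
  than for SLE(8/3, 0);

and `SLEKappaRho.one_half_lt_measure_I_notMem_fill` follows from the two (PROVED:
`SLEKappaRho.one_half_lt_measure_I_notMem_fill_of`; conversely the comparison follows from it
and the symmetry sentence, `SLEKappaRho.measure_I_notMem_fill_lt_of_neg_of`).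

PROVED, towards the two leaves: the **non-strict half of the asymmetry from Thm. 8.4 and the
symmetry sentence alone** (`SLEKappaRho.one_half_le_measure_I_notMem_fill_of`): if
`F^{ℝ₊}_ℍ(cl K_∞)` of SLE(8/3, ρ) has law `P⁺_{α(ρ)}` for all `ρ > −2` (Thm. 8.4, the named fact
`SLEKappaRho.isRightRestrictionMeasure_fill` of `SLEKappaRho`) and the SLE(8/3, 0) probability is
`1/2`, then `P{i ∉ F^{ℝ₊}_ℍ(cl K_∞)} ≥ 1/2` for `−2 < ρ < 0`. This goes through the printed
semigroup property of the one-sided measures ([LSW] §8.2, the sentence preceding Prop. 8.2: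
"Taking unions of independent hulls which satisfy the right-sided restriction property, yields
a realization of another right-sided restriction measure (and the exponent add up)"; two-sided
version: the first Remark following the proof of Prop. 3.3), PROVED here:

* `Literature.Probability.RandomPlanarGeometry.RightConfig.fillUnion K₁ K₂ = F^{ℝ₊}_ℍ(K₁ ∪ K₂) ∈ Ω₊`
  for `K₁, K₂ ∈ Ω₊` (`K₁ ∪ K₂` is closed, connected, unbounded, in `ℍ̄`, contains `0` and misses
  `(0, ∞)`, so the tree's `leftFilling_mem_rightConfigs` of `LeftFillingConfigs` applies),
  jointly measurable for the avoidance σ-fields (`{F(K₁ ∪ K₂) ∩ A = ∅} = {K₁ ∩ A = ∅} ∩ {K₂ ∩ A = ∅}`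
  for `A ∈ 𝒬₊`, `RightConfig.disjoint_leftFilling_union_iff`, from
  `disjoint_leftFilling_iff_of_isPlusHull`);
* `Literature.Probability.RandomPlanarGeometry.IsRightRestrictionMeasure.fillUnion` — **the
  exponents add up**: if `K₁ ~ P⁺_α` and `K₂ ~ P⁺_β` are independent then
  `F^{ℝ₊}_ℍ(K₁ ∪ K₂) ~ P⁺_{α+β}` (`P[F(K₁ ∪ K₂) ∩ A = ∅] = Φ'_A(0)^α Φ'_A(0)^β`);
* hence `P⁺_{5/8} = F(P⁺_α ⊗ P⁺_{5/8−α})` and `P⁺_{5/8}{i ∉ K} ≤ P⁺_α{i ∉ K}` for `0 < α < 5/8`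
  (`K₁ ⊆ F(K₁ ∪ K₂)`), where `P⁺_{5/8}{i ∉ K} = 1/2` is the symmetry sentence read through
  Thm. 8.4 at `ρ = 0` (`α(0) = 5/8`).

Status of the two leaves (split review, D-0026). The symmetry sentence is DISCHARGED higher in
the tree (`SLEKappaRho.measure_I_notMem_fill_eq_half_holds`, file
`RestrictionMeasuresFiveEighthsProofs`: the Bessel identity `∫₀ᵗ du/Z_u = (Z_t − √κ B_t)/(ρ + 2)`
of §8.3 giving `W = √κ B` a.s. for `ρ = 0`, the reflection invariance of the Wiener measure with
`Loewner.hull_imagAxisRefl`, and "a.s. `i` lies on exactly one side of the simple transient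
SLE_{8/3} trace", Rohde–Schramm 2005 Thm. 5.1, `hasSLETrace_of_ne_eight_holds`). With it, the
comparison sentence is EQUIVALENT to the fact it was cut from
(`SLEKappaRho.measure_I_notMem_fill_lt_of_neg_iff`, same file: `…_of` below and
`SLEKappaRho.one_half_lt_measure_I_notMem_fill_of`), so it is NOT an independent leaf: the split
review merges its proof obligation back into that of
`SLEKappaRho.one_half_lt_measure_I_notMem_fill` (its discharge is the one-liner
`SLEKappaRho.measure_I_notMem_fill_lt_of_neg_iff.2` of the parent's), and the `def` is kept only
because assembly theorems of `ConformalRestrictionFiveLeaves`, `ConformalRestrictionSevenLeaves`,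
`ConformalRestrictionUniqueLeaves`, `OneSidedRestrictionProofs`, `RestrictionMeasuresExistenceHolds`,
`RestrictionMeasuresFiveEighthsAssembly`, `…Positivity`, `…Proofs` and `SLEKappaRhoDriving` bind it
as a hypothesis. No proof of the comparison is printed ("It follows easily"), and the literal
route does not formalize as stated: under the monotone coupling `W ≤ √κ B` of p. 38 the pathwise
inclusion `{i ∉ F(cl K_∞(√κ B))} ⊆ {i ∉ F(cl K_∞(W))}` fails for general driving functions (the
region to the right of a hull is not monotone under boundary translations of its future
increments), and the strictness is not a consequence of Thm. 8.4 and the avoidance formula alone.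
What the tree proves instead: the comparison follows from the one-sided restriction martingale
of Lemmas 8.9–8.10 (`SLEKappaRho.exists_isOneSidedMartingale`, i.e. Thm. 8.4,
`SLEKappaRho.isRightRestrictionMeasure_fill_of_martingale`) together with the small-exponent
positivity "`P⁺_β{i ∈ K} > 0` for arbitrarily small `β > 0`"
(`SLEKappaRho.measure_I_notMem_fill_lt_of_neg_of_martingale_of_pos`, file
`RestrictionMeasuresFiveEighthsPositivity`; the non-strict half `≥ 1/2` is
`SLEKappaRho.one_half_le_measure_I_notMem_fill_of` below), and that positivity is PROVED from
the existence of any two-sided restriction measure of exponent `1`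
(`ExcursionCloud.small_exponent_positivity_of_exists_one`, file `OneSidedExcursionCloudInterior`,
after Lawler (2005) Prop. 9.13 / Cor. 9.11: left-filled Poissonian clouds of hung `P_1`-samples).
So the live debts behind both this sentence and its parent are exactly
`SLEKappaRho.exists_isOneSidedMartingale` and a `P_1` (the three existence-only §7 leaves, or
[LSW] Prop. 4.1): `SLEKappaRho.one_half_lt_measure_I_notMem_fill_of_martingale_of_exists_one`
(file `SLEKappaRhoAsymmetryLeaves`).

Mathlib: `MeasureTheory.Measure.prod_prod`, `MeasureTheory.Measure.map_apply`,
`measurable_generateFrom`, `Real.rpow_add`, `ENNReal.ofReal_mul`. Tree: `leftFilling`,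
`leftFilling_mem_rightConfigs`, `disjoint_leftFilling_iff_of_isPlusHull` (`SLEKappaRho`,
`LeftFillingConfigs`), `RightConfig`, `IsRightRestrictionMeasure` and its uniqueness
(`OneSidedRestriction`), `HasRestrictionDeriv.pos` (`RestrictionSemigroup`).
-/

noncomputable section

open Set Filter Topology MeasureTheory Metric
open UpperHalfPlane (upperHalfPlaneSet)
open scoped NNReal ENNReal
open Literature.Probability.Process (preWienerMeasure)

namespace Literature.Probability.RandomPlanarGeometry

/-! ### The filling of the union of two one-sided configurations -/

namespace RightConfig

variable (K₁ K₂ : RightConfig)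

/-- `0 ∈ K₁ ∪ K₂`. [folklore] -/
theorem zero_mem_union : (0 : ℂ) ∈ (K₁ : Set ℂ) ∪ K₂ :=
  Or.inl (K₁.nonposAxis_subset ⟨0, mem_Iic.2 le_rfl, by simp⟩)

/-- Positive reals are off `K₁ ∪ K₂`. [folklore] -/
theorem ofReal_notMem_union {x : ℝ} (hx : 0 < x) : (x : ℂ) ∉ (K₁ : Set ℂ) ∪ K₂ := by
  rintro (h | h)
  · exact absurd ((K₁.ofReal_mem_iff).1 h) (not_le.2 hx)
  · exact absurd ((K₂.ofReal_mem_iff).1 h) (not_le.2 hx)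

/-- `K₁ ∪ K₂` is closed. [folklore] -/
theorem isClosed_union : IsClosed ((K₁ : Set ℂ) ∪ K₂) :=
  K₁.isClosed.union K₂.isClosed

/-- `K₁ ∪ K₂ ⊆ ℍ̄`. [folklore] -/
theorem union_subset : (K₁ : Set ℂ) ∪ K₂ ⊆ {z : ℂ | 0 ≤ z.im} := by
  rintro z (h | h)
  · exact K₁.im_nonneg h
  · exact K₂.im_nonneg h

/-- `K₁ ∪ K₂` is connected (both contain `(−∞, 0]`). [folklore] -/
theorem isConnected_union : IsConnected ((K₁ : Set ℂ) ∪ K₂) :=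
  IsConnected.union ⟨0, K₁.nonposAxis_subset ⟨0, mem_Iic.2 le_rfl, by simp⟩,
    K₂.nonposAxis_subset ⟨0, mem_Iic.2 le_rfl, by simp⟩⟩ K₁.isConnected K₂.isConnected

/-- `K₁ ∪ K₂ ⊆ F^{ℝ₊}_ℍ(K₁ ∪ K₂)`. [folklore] -/
theorem union_subset_leftFilling : (K₁ : Set ℂ) ∪ K₂ ⊆ leftFilling ((K₁ : Set ℂ) ∪ K₂) :=
  fun _ hz ↦ inter_subset_leftFilling _ ⟨hz, union_subset K₁ K₂ hz⟩

/-- **`F^{ℝ₊}_ℍ(K₁ ∪ K₂) ∈ Ω₊` for `K₁, K₂ ∈ Ω₊`** ([LSW] §8.2, sentence preceding Prop. 8.2: the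
filling of a union of (independent) one-sided hulls realizes again a one-sided restriction
measure, in particular it is `Ω₊`-valued): closed, connected, in `ℍ̄`, meeting `ℝ` exactly in
`(−∞, 0]`, with connected complement in `ℍ`.
[cite: LawlerSchrammWerner2003Restriction, §8.2 (sentence preceding Prop. 8.2) with §8.1 p. 31 (Ω₊)] -/
theorem leftFilling_union_mem_rightConfigs : leftFilling ((K₁ : Set ℂ) ∪ K₂) ∈ rightConfigs :=
  leftFilling_mem_rightConfigs (isClosed_union K₁ K₂) (union_subset K₁ K₂) (isConnected_union K₁ K₂)
    (zero_mem_union K₁ K₂) (fun h ↦ K₁.not_isBounded (h.subset subset_union_left))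
    fun _ hx ↦ ofReal_notMem_union K₁ K₂ hx

/-- **The filled union `F^{ℝ₊}_ℍ(K₁ ∪ K₂) ∈ Ω₊`** of two one-sided configurations ([LSW] §8.2,
sentence preceding Prop. 8.2: "Taking unions of independent hulls which satisfy the right-sided
restriction property, yields a realization of another right-sided restriction measure").
[cite: LawlerSchrammWerner2003Restriction, §8.2 (sentence preceding Prop. 8.2)] -/
def fillUnion : RightConfig :=
  ⟨leftFilling ((K₁ : Set ℂ) ∪ K₂), leftFilling_union_mem_rightConfigs K₁ K₂⟩

/-- The underlying set of the filled union. [folklore] -/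
@[simp] theorem coe_fillUnion : ((fillUnion K₁ K₂ : RightConfig) : Set ℂ) = leftFilling ((K₁ : Set ℂ) ∪ K₂) :=
  rfl

/-- `K₁ ⊆ F(K₁ ∪ K₂)`. [folklore] -/
theorem subset_fillUnion_left : (K₁ : Set ℂ) ⊆ (fillUnion K₁ K₂ : Set ℂ) :=
  subset_union_left.trans (union_subset_leftFilling K₁ K₂)

/-- `K₂ ⊆ F(K₁ ∪ K₂)`. [folklore] -/
theorem subset_fillUnion_right : (K₂ : Set ℂ) ⊆ (fillUnion K₁ K₂ : Set ℂ) :=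
  subset_union_right.trans (union_subset_leftFilling K₁ K₂)

/-- **`F(K₁ ∪ K₂) ∩ A = ∅ ⟺ K₁ ∩ A = ∅` and `K₂ ∩ A = ∅`, for `A ∈ 𝒬₊`** (a `+`-hull missed
by `K₁ ∪ K₂` lies, with the positive real axis, in the component of `1` of
`ℍ̄ ∖ (K₁ ∪ K₂)`: `disjoint_leftFilling_iff_of_isPlusHull`). This is the identity
`P[K ⊂ Φ⁻¹(ℍ)] = ∏ⱼ P[Kⱼ ⊂ Φ⁻¹(ℍ)]` behind "the exponent add up".
[cite: LawlerSchrammWerner2003Restriction, §8.2 (sentence preceding Prop. 8.2) with the first Remark after Prop. 3.3] -/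
theorem disjoint_leftFilling_union_iff {A : Set ℂ} (hA : IsPlusHull A) :
    Disjoint (leftFilling ((K₁ : Set ℂ) ∪ K₂)) A ↔
      Disjoint (K₁ : Set ℂ) A ∧ Disjoint (K₂ : Set ℂ) A := by
  rw [disjoint_leftFilling_iff_of_isPlusHull (fun _ hx ↦ ofReal_notMem_union K₁ K₂ hx) hA,
    disjoint_union_left]

/-- The avoidance event of a `+`-hull pulls back under the filled union to the product of the
avoidance events. [folklore] -/
theorem fillUnion_preimage_avoid {A : Set ℂ} (hA : IsPlusHull A) :
    (fun p : RightConfig × RightConfig ↦ fillUnion p.1 p.2) ⁻¹' avoid A = avoid A ×ˢ avoid A := by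
  ext ⟨K₁, K₂⟩
  simp only [mem_preimage, mem_avoid, coe_fillUnion, mem_prod]
  exact disjoint_leftFilling_union_iff K₁ K₂ hA

/-- **The filled union `Ω₊ × Ω₊ → Ω₊` is measurable** for the avoidance σ-fields. [folklore] -/
theorem measurable_fillUnion : Measurable fun p : RightConfig × RightConfig ↦ fillUnion p.1 p.2 := by
  refine measurable_generateFrom ?_
  rintro _ ⟨A, hA, rfl⟩
  rw [fillUnion_preimage_avoid hA]
  exact (measurableSet_avoid hA).prod (measurableSet_avoid hA)

end RightConfig

/-! ### The exponents add up ([LSW] §8.2) -/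

/-- **The semigroup property of the one-sided restriction measures** ([LSW] §8.2, the sentence
preceding Prop. 8.2: "Taking unions of independent hulls which satisfy the right-sided
restriction property, yields a realization of another right-sided restriction measure (and the
exponent add up)"; the two-sided version is the first Remark after Prop. 3.3: "the law of the
filling of the union of the `K_j`'s is `P_α` with `α = α₁ + ⋯ + α_n` because
`P[K ⊂ Φ⁻¹(ℍ)] = ∏ P[K_j ⊂ Φ⁻¹(ℍ)] = Φ'(0)^{α₁ + ⋯ + α_n}`"): if `K₁ ~ P⁺_α` and `K₂ ~ P⁺_β` are
independent then `F^{ℝ₊}_ℍ(K₁ ∪ K₂) ~ P⁺_{α+β}`.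
[cite: LawlerSchrammWerner2003Restriction, §8.2 (sentence preceding Prop. 8.2)] -/
theorem IsRightRestrictionMeasure.fillUnion {α β : ℝ} {Q₁ Q₂ : Measure RightConfig}
    (h₁ : IsRightRestrictionMeasure α Q₁) (h₂ : IsRightRestrictionMeasure β Q₂) :
    IsRightRestrictionMeasure (α + β)
      ((Q₁.prod Q₂).map fun p : RightConfig × RightConfig ↦ RightConfig.fillUnion p.1 p.2) := by
  haveI := h₁.1
  haveI := h₂.1
  refine ⟨Measure.isProbabilityMeasure_map RightConfig.measurable_fillUnion.aemeasurable, ?_⟩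
  intro A hA Φ hΦ d hd
  have hd0 : 0 < d := hd.pos IsStarHull.exists_hasRestrictionDeriv_holds hA.1 hΦ
  rw [Measure.map_apply RightConfig.measurable_fillUnion (RightConfig.measurableSet_avoid hA),
    RightConfig.fillUnion_preimage_avoid hA, Measure.prod_prod, h₁.2 hA hΦ hd, h₂.2 hA hΦ hd,
    ← ENNReal.ofReal_mul (Real.rpow_nonneg hd0.le _), Real.rpow_add hd0]

/-- **`P⁺_{α+β}{i ∉ K} ≤ P⁺_α{i ∉ K}`**: in the realization `P⁺_{α+β} = F(P⁺_α ⊗ P⁺_β)`,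
`{i ∉ F(K₁ ∪ K₂)} ⊆ {i ∉ K₁}`. [cite: LawlerSchrammWerner2003Restriction, §8.2 (sentence preceding Prop. 8.2)] -/
theorem IsRightRestrictionMeasure.measure_notMem_le_of_add {α β : ℝ} {Q₁ Q₂ Q : Measure RightConfig}
    (h₁ : IsRightRestrictionMeasure α Q₁) (h₂ : IsRightRestrictionMeasure β Q₂)
    (h : IsRightRestrictionMeasure (α + β) Q) {z : ℂ} (hz : z ∈ upperHalfPlaneSet) :
    Q {K : RightConfig | z ∉ (K : Set ℂ)} ≤ Q₁ {K : RightConfig | z ∉ (K : Set ℂ)} := by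
  haveI := h₁.1
  haveI := h₂.1
  rw [h.unique (h₁.fillUnion h₂),
    Measure.map_apply RightConfig.measurable_fillUnion (RightConfig.measurableSet_notMem hz)]
  calc (Q₁.prod Q₂) ((fun p : RightConfig × RightConfig ↦ RightConfig.fillUnion p.1 p.2) ⁻¹'
          {K : RightConfig | z ∉ (K : Set ℂ)})
      ≤ (Q₁.prod Q₂) ({K : RightConfig | z ∉ (K : Set ℂ)} ×ˢ (univ : Set RightConfig)) := by
        refine measure_mono ?_
        rintro ⟨K₁, K₂⟩ hp
        refine ⟨fun hzK ↦ hp ?_, mem_univ _⟩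
        exact RightConfig.subset_fillUnion_left K₁ K₂ hzK
    _ = Q₁ {K : RightConfig | z ∉ (K : Set ℂ)} := by
        rw [Measure.prod_prod, measure_univ, mul_one]

/-! ### The two printed sentences as named facts, and the assembly of `one_half_lt_measure_I_notMem_fill` -/

/-- NAMED FACT — **"the corresponding quantity for SLE(8/3, 0), which is `1/2` by symmetry"**
([LSW] proof of Cor. 8.6, p. 38, end of the second sentence): for every SLE(8/3, 0) driving
pair `(O, W)` the probability that `i` ends up to the right of the right hand boundary, i.e.
`P{i ∉ F^{ℝ₊}_ℍ(cl K_∞)}`, equals `1/2`. Here SLE(8/3, 0) is ordinary chordal SLE_{8/3} ([LSW]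
§8.3: "Note that when `ρ = 0`, we get the ordinary chordal SLE_κ"; with
"`∫₀ᵗ du/Z_u = (Z_t − √κ B_t)/(ρ + 2)`" one has `W_t = Z_t − 2∫₀ᵗ du/Z_u = √κ B_t` a.s.). Printed
ingredients of "by symmetry": the law of SLE_{8/3} is invariant under `x + iy ↦ −x + iy`
(the tree's `Loewner.hull_imagAxisRefl` with the symmetry of the Wiener measure), which
exchanges `{i right of K_∞}` and `{i left of K_∞}`; and almost surely exactly one of the two
holds — `i ∉ γ` and `ℍ ∖ γ` has two components, one bordering `[0, ∞)` and one bordering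
`(−∞, 0]`, because the SLE_{8/3} trace `γ` is a simple curve from `0` to `∞` (Rohde–Schramm
2005, Thms. 5.1, 6.1, 7.1; in the tree `HasSLETrace`, transience
`tendsto_norm_sleTrace_atTop_of_lt_four`, and the Jordan curve theorem
`Literature.Topology.PlaneTopology.JordanCurveTheorem_holds`). Not in the tree: the Bessel
identity for `ρ = 0`, the SLE_{8/3} trace theorem itself (named facts `RohdeSchramm2005_cor35`,
`hasSLETrace_of_ne_eight`), simplicity of the trace for `κ ≤ 4`.
[cite: LawlerSchrammWerner2003Restriction, proof of Cor. 8.6 (p. 38), second sentence ("which is 1/2 by symmetry"), with §8.3 (SLE(κ, 0) = SLE_κ)] -/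
def SLEKappaRho.measure_I_notMem_fill_eq_half : Prop :=
  ∀ {O W : ℝ≥0 → (ℝ≥0 → ℝ) → ℝ}, IsSLEKappaRhoPair (8 / 3) 0 O W →
    preWienerMeasure {ω | Complex.I ∉ sleKappaRhoFill W ω} = 1 / 2

/-- NAMED FACT — **the comparison of SLE(8/3, ρ), `ρ < 0`, with SLE(8/3, 0)** ([LSW] proof of
Cor. 8.6, p. 38, first two sentences): "Note that when `ρ < 0`, `W_t − √κ B_t` is decreasing. It
follows easily that the probability that `i` ends up eventually to 'the right' of the right hand
boundary of SLE(8/3, ρ) […] is strictly larger than the corresponding quantity for SLE(8/3, 0)".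
Stated for `−2 < ρ < 0`, every SLE(8/3, ρ) driving pair `(O, W)` and every SLE(8/3, 0) driving
pair `(O₀, W₀)` (all on the canonical space of the tree's Brownian motion, so that
`W_t − W₀_t = ρ ∫₀ᵗ du/Z_u` a.s. is indeed non-increasing): `P{i ∉ F^{ℝ₊}_ℍ(cl K_∞(W₀))} <
P{i ∉ F^{ℝ₊}_ℍ(cl K_∞(W))}`. No proof is printed, and the pathwise inclusion of the two events
under the coupling `W ≤ √κ B` fails for general driving functions. STATUS (split review,
D-0026): NOT an independent leaf — with the symmetry sentence proved
(`SLEKappaRho.measure_I_notMem_fill_eq_half_holds`) this fact is EQUIVALENT to its parent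
`SLEKappaRho.one_half_lt_measure_I_notMem_fill` (`SLEKappaRho.measure_I_notMem_fill_lt_of_neg_iff`,
file `RestrictionMeasuresFiveEighthsProofs`; `…_of` below and its converse), into whose proof
obligation it is merged: do not seat it separately; its discharge is
`SLEKappaRho.measure_I_notMem_fill_lt_of_neg_iff.2` of the parent's, equivalently
`SLEKappaRho.measure_I_notMem_fill_lt_of_neg_of_martingale_of_pos` (file
`RestrictionMeasuresFiveEighthsPositivity`) fed with `SLEKappaRho.exists_isOneSidedMartingale_holds`
(Lemmas 8.9–8.10, open) and `ExcursionCloud.small_exponent_positivity_of_exists_one` (file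
`OneSidedExcursionCloudInterior`, proved) applied to any two-sided `P_1`. The `def` is retained
because assembly theorems in nine files bind it as a hypothesis.
[cite: LawlerSchrammWerner2003Restriction, proof of Cor. 8.6 (p. 38), first two sentences] -/
def SLEKappaRho.measure_I_notMem_fill_lt_of_neg : Prop :=
  ∀ {ρ : ℝ} {O W O₀ W₀ : ℝ≥0 → (ℝ≥0 → ℝ) → ℝ}, -2 < ρ → ρ < 0 → IsSLEKappaRhoPair (8 / 3) ρ O W →
    IsSLEKappaRhoPair (8 / 3) 0 O₀ W₀ →
      preWienerMeasure {ω | Complex.I ∉ sleKappaRhoFill W₀ ω} <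
        preWienerMeasure {ω | Complex.I ∉ sleKappaRhoFill W ω}

/-- **[LSW] p. 38, first two sentences ⇒ `SLEKappaRho.one_half_lt_measure_I_notMem_fill`**: the
comparison with SLE(8/3, 0) (`h₂`) and the value `1/2` for SLE(8/3, 0) (`h₁`; SLE(8/3, 0) pairs
exist, `exists_isSLEKappaRhoPair`) give `P{i ∉ F^{ℝ₊}_ℍ(cl K_∞)} > 1/2` for `−2 < ρ < 0`.
[cite: LawlerSchrammWerner2003Restriction, proof of Cor. 8.6 (p. 38), first two sentences] -/
theorem SLEKappaRho.one_half_lt_measure_I_notMem_fill_of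
    (h₁ : SLEKappaRho.measure_I_notMem_fill_eq_half)
    (h₂ : SLEKappaRho.measure_I_notMem_fill_lt_of_neg) :
    SLEKappaRho.one_half_lt_measure_I_notMem_fill := by
  intro ρ O W hρ hρ0 hOW
  obtain ⟨O₀, W₀, h0⟩ := exists_isSLEKappaRhoPair (8 / 3) 0
  have h := h₂ hρ hρ0 hOW h0
  rwa [h₁ h0] at h

/-- Conversely the comparison sentence follows from `SLEKappaRho.one_half_lt_measure_I_notMem_fill`
and the symmetry sentence (so that, given the latter, the two are equivalent).
[cite: LawlerSchrammWerner2003Restriction, proof of Cor. 8.6 (p. 38), first two sentences] -/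
theorem SLEKappaRho.measure_I_notMem_fill_lt_of_neg_of
    (h₁ : SLEKappaRho.measure_I_notMem_fill_eq_half)
    (h : SLEKappaRho.one_half_lt_measure_I_notMem_fill) :
    SLEKappaRho.measure_I_notMem_fill_lt_of_neg := by
  intro ρ O W O₀ W₀ hρ hρ0 hOW h0
  rw [h₁ h0]
  exact h hρ hρ0 hOW

/-! ### The non-strict half of the asymmetry from Thm. 8.4 and the symmetry sentence -/

/-- The law of an `Ω₊`-valued version `Kc` of `K = F^{ℝ₊}_ℍ(cl K_∞)` gives the event
`{K' : i ∉ K'}` the Wiener measure of `{i ∉ K}`. [folklore] -/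
theorem SLEKappaRho.map_apply_setOf_I_notMem {W : ℝ≥0 → (ℝ≥0 → ℝ) → ℝ}
    {Kc : (ℝ≥0 → ℝ) → RightConfig} (hKc : Measurable Kc)
    (hae : ∀ᵐ ω ∂preWienerMeasure, (Kc ω : Set ℂ) = sleKappaRhoFill W ω) :
    (preWienerMeasure.map Kc) {K : RightConfig | Complex.I ∉ (K : Set ℂ)} =
      preWienerMeasure {ω | Complex.I ∉ sleKappaRhoFill W ω} := by
  have hI : (Complex.I : ℂ) ∈ upperHalfPlaneSet := by
    show 0 < Complex.I.im
    simp
  rw [Measure.map_apply hKc (RightConfig.measurableSet_notMem hI)]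
  refine measure_congr (hae.mono fun ω hω ↦ ?_)
  show (Complex.I ∉ (Kc ω : Set ℂ)) = (Complex.I ∉ sleKappaRhoFill W ω)
  rw [hω]

/-- `α(0) = 5/8`: SLE(8/3, 0) = SLE_{8/3} has exponent `(3·0 + 10)(2 + 0)/32 = 5/8`. [cite: LawlerSchrammWerner2003Restriction, Thm. 8.4 (p. 37)] -/
theorem sleKappaRhoExponent_zero : sleKappaRhoExponent 0 = 5 / 8 := by
  norm_num [sleKappaRhoExponent]

/-- **The non-strict half of the asymmetry of SLE(8/3, ρ), `ρ < 0`, from Thm. 8.4 and the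
symmetry sentence**: if `F^{ℝ₊}_ℍ(cl K_∞)` of SLE(8/3, ρ) has law `P⁺_{α(ρ)}` for every `ρ > −2`
(`h84`, [LSW] Thm. 8.4) and the SLE(8/3, 0) probability of `{i ∉ F^{ℝ₊}_ℍ(cl K_∞)}` is `1/2`
(`h₀`), then this probability is `≥ 1/2` for `−2 < ρ < 0`: with `α = α(ρ) ∈ (0, 5/8)` and
`β = 5/8 − α > 0` (for which `P⁺_β` exists by Thm. 8.4, `exists_isRightRestrictionMeasure_of_sleKappaRho`),
`P⁺_{5/8} = F(P⁺_α ⊗ P⁺_β)` by the semigroup property (§8.2) and uniqueness (§8.1), so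
`1/2 = P⁺_{5/8}{i ∉ K} ≤ P⁺_α{i ∉ K} = P{i ∉ F^{ℝ₊}_ℍ(cl K_∞)}`. (The strict inequality printed on
p. 38 needs more: `P⁺_β{i ∈ K} > 0`.)
[cite: LawlerSchrammWerner2003Restriction, proof of Cor. 8.6 (p. 38) with Thm. 8.4 (p. 37) and §8.2 (sentence preceding Prop. 8.2)] -/
theorem SLEKappaRho.one_half_le_measure_I_notMem_fill_of
    (h84 : SLEKappaRho.isRightRestrictionMeasure_fill)
    (h₀ : SLEKappaRho.measure_I_notMem_fill_eq_half)
    {ρ : ℝ} {O W : ℝ≥0 → (ℝ≥0 → ℝ) → ℝ} (hρ : -2 < ρ) (hρ0 : ρ < 0)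
    (hOW : IsSLEKappaRhoPair (8 / 3) ρ O W) :
    1 / 2 ≤ preWienerMeasure {ω | Complex.I ∉ sleKappaRhoFill W ω} := by
  have hI : (Complex.I : ℂ) ∈ upperHalfPlaneSet := by
    show 0 < Complex.I.im
    simp
  set α : ℝ := sleKappaRhoExponent ρ with hα
  have hα58 : α < 5 / 8 := (sleKappaRhoExponent_lt_five_eighths_iff hρ).2 hρ0
  -- `P⁺_α` as the law of `K` for SLE(8/3, ρ)
  obtain ⟨Kc, hKc, hae, hQ⟩ := h84 hρ hOW
  rw [← SLEKappaRho.map_apply_setOf_I_notMem hKc hae]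
  -- `P⁺_β`, `β = 5/8 − α`
  obtain ⟨Qβ, hQβ⟩ := exists_isRightRestrictionMeasure_of_sleKappaRho h84 (5 / 8 - α) (by linarith)
  -- `P⁺_{5/8}` as the law of `K` for SLE(8/3, 0), where `{i ∉ K}` has probability `1/2`
  obtain ⟨O₀, W₀, h0⟩ := exists_isSLEKappaRhoPair (8 / 3) 0
  obtain ⟨Kc₀, hKc₀, hae₀, hQ₀⟩ := h84 (by norm_num : (-2 : ℝ) < 0) h0
  rw [sleKappaRhoExponent_zero] at hQ₀
  have h58 : IsRightRestrictionMeasure (α + (5 / 8 - α)) (preWienerMeasure.map Kc₀) := by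
    rwa [add_sub_cancel]
  calc (1 / 2 : ℝ≥0∞) = preWienerMeasure {ω | Complex.I ∉ sleKappaRhoFill W₀ ω} := (h₀ h0).symm
    _ = (preWienerMeasure.map Kc₀) {K : RightConfig | Complex.I ∉ (K : Set ℂ)} :=
        (SLEKappaRho.map_apply_setOf_I_notMem hKc₀ hae₀).symm
    _ ≤ (preWienerMeasure.map Kc) {K : RightConfig | Complex.I ∉ (K : Set ℂ)} :=
        hQ.measure_notMem_le_of_add hQβ h58 hI

end Literature.Probability.RandomPlanarGeometry

end
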